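import Literature.AnabelianGeometry.EtaleTheta.SettingModelChiShearOddLevel
import Literature.AnabelianGeometry.EtaleTheta.SettingModelChiTate2
import HarnessLib

/-!
# The Tate shear does NOT descend to `Heis(ℤ/2)` — sharpness of the odd-level descent (R78 cluster, stage 2)

Mochizuki, *The étale theta function …*, Publ. RIMS **45** (2009) [EtTh], §1, PRIMS PDF pp. 12–13
[cite: MochizukiEtTh2009, §1 p.13].  abc-iut cell, layer L2, prover abc-iut-L2-d1 (gen 5); PROOF-ONLY companion of this
seat's `SettingModelChiShearOddLevel` (`hHat_shear_of_two_mul_eq_one`: for ODD `N` the shear `a ↦ a·b^k`, `b ↦ b`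
descends to `Heis(ℤ/N)`), turning abc-iut-L6-d6's hand computation (R78-MAP #5 KERNEL WARNING, 07:49Z) into a
kernel-checked statement: at the EVEN level `N = 2`, for a shear parameter `k` that is odd mod `2`, there is NO map
`δ : Heis(ℤ/2) → Heis(ℤ/2)` (let alone a homomorphism) with `ĥ₂ ∘ shear k = δ ∘ ĥ₂` on `F̂₂` — the witnesses are
`x₁ := (η a)²` and `x₂ := 1`: both have `ĥ₂ = 1`, but `ĥ₂(shear k x₁) = ĥ₂((η a · b^k)²) = (2, 2, 3) = (0, 0, 1) ≠ 1 =
ĥ₂(shear k 1)`.  So the parity hypothesis in the odd-level descent (and in the choice `X̲̲`, `l` odd) is SHARP, and the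
stage-2 tower's restriction to the level laws (h1)/(h2) at even `N` is forced.  Pure group theory of the model;
nothing of [EtTh] asserted; no side taken on [IUTchIII] Cor. 3.12.
-/

noncomputable section

namespace Literature.AnabelianGeometry.EtaleTheta.SettingModel

open Literature.AnabelianGeometry.SemiGraphs _root_.Function

/-- `ĥ₂((η a)²) = 1` (`(1,0,0)² = (2,0,0) = 1` in `Heis(ℤ/2)`). [cite: MochizukiEtTh2009, §1 p.13] -/
theorem hHat_two_eta_of_zero_sq : hHat 2 (eta (FreeGroup.of 0) ^ 2) = 1 := by
  rw [map_pow, hHat_eta, heisHom_of_zero, pow_two]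
  ext <;> simp <;> decide

/-- `ĥ₂(shear k ((η a)²)) = (0, 0, 1)` when `k ≡ 1 (mod 2)` (`(η a · b^k)² ↦ (1,1,1)² = (2,2,3)`).
[cite: MochizukiEtTh2009, §1 p.13] -/
theorem hHat_two_shear_eta_of_zero_sq (k : ZH) (hk : ZHatLevel.level 2 k = Multiplicative.ofAdd 1) :
    hHat 2 (shear k (eta (FreeGroup.of 0) ^ 2)) = ⟨0, 0, 1⟩ := by
  rw [map_pow, shear_eta_of_zero, map_pow, map_mul, hHat_bPow, hk, toAdd_ofAdd, hHat_eta, heisHom_of_zero, pow_two]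
  ext <;> simp <;> decide

/-- **The Tate shear with odd parameter has NO level-`2` shadow**: no map `δ : Heis(ℤ/2) → Heis(ℤ/2)` satisfies
`ĥ₂ (shear k x) = δ (ĥ₂ x)` for all `x ∈ F̂₂` (witnesses `(η a)²` and `1`).  Sharpness of the parity hypothesis of
`hHat_shear_of_two_mul_eq_one`. [cite: MochizukiEtTh2009, §1 p.13] -/
theorem not_exists_shear_level_two_shadow (k : ZH) (hk : ZHatLevel.level 2 k = Multiplicative.ofAdd 1) :
    ¬ ∃ δ : Heis (ZMod (2 : ℕ+)) → Heis (ZMod (2 : ℕ+)), ∀ x : F₂hatT, hHat 2 (shear k x) = δ (hHat 2 x) := by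
  rintro ⟨δ, hδ⟩
  have h1 : δ 1 = 1 := by
    have h := hδ 1
    rw [map_one, map_one] at h
    exact h.symm
  have h2 : δ 1 = ⟨0, 0, 1⟩ := by
    rw [← hHat_two_eta_of_zero_sq, ← hδ, hHat_two_shear_eta_of_zero_sq k hk]
  have hz := congrArg Heis.z (h1.symm.trans h2)
  rw [Heis.one_z] at hz
  exact absurd hz (by decide)

/-- In particular no ENDOMORPHISM of `Heis(ℤ/2)` is a level-`2` shadow of such a shear (contrast `Heis.levelShear` at
odd level). [cite: MochizukiEtTh2009, §1 p.13] -/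
theorem not_exists_shear_level_two_hom (k : ZH) (hk : ZHatLevel.level 2 k = Multiplicative.ofAdd 1) :
    ¬ ∃ δ : Heis (ZMod (2 : ℕ+)) →* Heis (ZMod (2 : ℕ+)), ∀ x : F₂hatT, hHat 2 (shear k x) = δ (hHat 2 x) := by
  rintro ⟨δ, hδ⟩
  exact not_exists_shear_level_two_shadow k hk ⟨δ, hδ⟩

/-- **Summary**: the shear `a ↦ a·b`, `b ↦ b` has no level-`2` shadow, while at every odd level it has the explicit shadow
`Heis.levelShear ½ 1` (`hHat_shear_of_two_mul_eq_one`; the odd parameter `ι 1` by abc-iut-w5-d051's `level_two_iotaZ_one`).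
[cite: MochizukiEtTh2009, §1 p.13] -/
theorem shear_descends_iff_witness :
    (¬ ∃ δ : Heis (ZMod (2 : ℕ+)) → Heis (ZMod (2 : ℕ+)),
        ∀ x : F₂hatT, hHat 2 (shear (iotaZ (Multiplicative.ofAdd 1)) x) = δ (hHat 2 x)) ∧
      ∀ (N : ℕ+), Odd (N : ℕ) → ∃ δ : Heis (ZMod N) →* Heis (ZMod N),
        ∀ x : F₂hatT, hHat N (shear (iotaZ (Multiplicative.ofAdd 1)) x) = δ (hHat N x) :=
  ⟨not_exists_shear_level_two_shadow _ level_two_iotaZ_one, fun N hN => by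
    obtain ⟨e, he, h⟩ := exists_levelShear_hHat_shear_of_odd N hN (iotaZ (Multiplicative.ofAdd 1))
    exact ⟨_, h⟩⟩

end Literature.AnabelianGeometry.EtaleTheta.SettingModel

end
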